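import Summits.Ventures.YMGap.RobustBall.ConcentrationKR
import Summits.Ventures.YMGap.RobustBall.ConcentrationLatticeSums
import Summits.Ventures.YMGap.RobustBall.UniformLoopCorrelatorDecay
import HarnessLib

/-!
# Venture YMGap, track ROBUST-BALL — GAUSSIAN CONCENTRATION, step 5: uniformly on the tier-1 `ℤ^d` ball (pair door),
# hypothesis-free for `SU(2)`, every `N` through Bakry–Émery, and the Wilson point

HONEST FRAMING. WHAT THIS IS: a venture file (cell `pub-ymgap`, track Y2 ROBUST-BALL, seat ds-3, theorems only): the
door-level concentration theorems (`ConcentrationKR.lean`) with the explicit proxies of `ConcentrationLatticeSums.lean`, fed through rb-p1's single-link pair door exactly as in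
`BoundaryDecayBall.lean`. For a Lipschitz cylinder `f` (constant `K`, links `Δ`), ANY finite set `B` of lattice
translations, and `v(ρ, R) := 16 N K² d #Δ² Θ₁²`, `Θ₁ = ((1 + r₁)/(1 − r₁))^d`, `r₁ = exp(log max(ρ,½) / (d max(1,R)))`:

* PAIR DOOR, every `d ≥ 1`, `N ≥ 1` (`translates_average_ge_le_of_pair`): one-link Poincaré constant `c` and linear
  variance bound `v₀` on the operator-norm ball `b ≥ 2(d−1)|β|`, `6(d−1)|β| e^{ε₀}√(c v₀) + e^{ε₀/2}√c ε₁ ≤ ρ < 1` ⇒ for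
  EVERY member of `MemBallZd ε₀ ε₁ R`, EVERY DLR state `μ`, `B` nonempty, `a ≥ 0`:
  `μ{|Σ_{x∈B} f∘θ_x − ∫ Σ dμ| ≥ a·#B} ≤ 2 exp(−2 a² #B / v(ρ, R))`;
* `SU(2)` HYPOTHESIS-FREE, every `d` (`su2_translates_average_ge_le`: `2(d−1)|β_W| e^{ε₀} + e^{ε₀/2}√(2/3) ε₁ ≤ ρ < 1`,
  Wilson units `β = β_W/4`) and `d = 4` (`su2_translates_average_ge_le_dim4`: `6|β_W| e^{ε₀} + … ≤ ρ`);
* DOOR LEVEL WITH EXPLICIT PROXIES (`ConcentrationLatticeSums.lean` plugged into `ConcentrationKR.lean`): one observable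
  `dlr_abs_sub_integral_ge_le_explicit` (`μ{|F − ∫ F dμ| ≥ r} ≤ 2 exp(−2 r² / (16 N K² d #Δ² Θ₂))`), translate sums
  `dlr_translates_abs_sub_integral_ge_le`, empirical averages `dlr_translates_average_ge_le` (`v(ρ,R) · #B`);
* ALL `N ≥ 2` through the Bakry–Émery pair (`suN_translates_average_ge_le_bakryEmery`);
* THE WILSON POINT (`su2_wilson_translates_average_upTo_oneTwelfth`): `SU(2)` lattice Yang–Mills on `ℤ⁴`, `0 ≤ β_W ≤ 1/12`
  (tree coupling `β_W/2`; the zero member, row sum `6β_W ≤ 1/2`, range `0`): EVERY DLR state `μ` satisfies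
  `μ{|Σ_{x∈B} f∘θ_x − ∫ Σ dμ| ≥ a·#B} ≤ 2 exp(−2 a² #B / (128 K² #Δ² Θ₁²))`, `Θ₁ = ((1 + 2^{−1/4})/(1 − 2^{−1/4}))⁴` — the
  empirical average of any gauge-invariant local observable (e.g. the plaquette) over ANY finite region of `#B` sites deviates
  from its mean by `a` with probability exponentially small IN THE NUMBER OF SITES; Wilson loops `W_γ` of any closed walk `γ`:
  `su2_wilson_loop_translates_average_upTo_oneTwelfth` (`256 c² |γ|² #links(γ)² Θ₁²`); THE PLAQUETTE (tree `zdPlaquetteObs`):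
  `su2_wilson_plaquette_average_upTo_oneTwelfth` (`128·32²·#links(p)²·Θ₁²`).

WHAT THIS IS NOT: the constants `Θ` are those of the lossy `ℓ¹` comparison (at the Wilson point `Θ₁ ≈ 1.8·10⁴`, an
order of magnitude above the true lattice sum — not optimised; the content is the RATE in `#B`); Gaussian UPPER bounds inside the single-link doors only (not the vertex-star window),
not an LDP, not a CLT; strong-coupling LATTICE statements, nothing about the continuum limit or the Clay Millennium
problem.

References: C. Külske, Comm. Math. Phys. 239 (2003) 29–51, Thm. 1 / Cor. 1; C. McDiarmid, Surveys in Combinatorics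
1989, Lemma (1.2); the tree's `BoundaryDecayBall.lean` (door feeding), `ConcentrationKR.lean`, `ConcentrationLatticeSums.lean`.
-/

noncomputable section

open MeasureTheory Filter Function ProbabilityTheory Real
open scoped NNReal Topology
open Literature.Probability.LatticeModels
open Literature.Probability.LatticeModels.DobrushinMetric
open Literature.MathematicalPhysics.QuantumLattice
open Literature.MathematicalPhysics.QuantumFieldTheory hiding ZdEdge Site
open Literature.MathematicalPhysics.QuantumFieldTheory (walkEdges)
open SimpleGraph
open Summit.QuantumFields.BalabanUV.InfraRed.StrongCouplingPoincareDoorSUN (oneLinkPoincareSUN_two_sharp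
  oneLinkPoincareSUN_bakryEmery)
open Summit.QuantumFields.BalabanUV.InfraRed.StrongCouplingVarianceDoorSUN (oneLinkVarianceBound_bakryEmery)

namespace Summit.Ventures.YMGap.RobustBall

variable {d N : ℕ}

/-! ### Explicit proxies plugged in (door level): one local observable, translate sums at the volume scale -/

/-- **GAUSSIAN CONCENTRATION WITH AN EXPLICIT PROXY, one local observable, from ANY robust single-link door**: under
the hypotheses of `abs_kernel_sub_kernel_le_of_isKRContraction` (`d ≥ 1`, `0 ≤ ρ`), for EVERY DLR state `μ`, every
Lipschitz cylinder `F` (constant `K`, links `Δ`) and every `r ≥ 0`: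
`μ{|F − ∫ F dμ| ≥ r} ≤ 2 exp(−2 r² / (16 N K² d #Δ² Θ₂))`, `Θ₂ = ((1+r₂)/(1−r₂))^d`, `r₂ = exp(2 log max(ρ,½)/(d max(1,R)))`
(the one-element family in `dlr_sum_abs_sub_integral_ge_le_of_isKRContraction` + `sum_boxLinks_influence_sq_le`). [folklore] -/
theorem dlr_abs_sub_integral_ge_le_explicit (hd : 1 ≤ d) {β ρ R : ℝ}
    {W : Potential (ZdEdge d) (Matrix.specialUnitaryGroup (Fin N) ℂ)} (hW : W.IsAdapted)
    (hWb : ∀ X, ∃ C, ∀ U, |W X U| ≤ C)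
    {supp : Finset (ZdEdge d) → Finset (Finset (ZdEdge d))} (hsupp : W.IsSupportedBy supp)
    {C : ZdEdge d → ZdEdge d → ℝ}
    (hKR : IsKRContraction (perturbedYM (d := d) (fundamentalRep (Fin N)) (N * β) W supp) suFrobDist
      (perturbedNbr supp) C)
    (hrow : ∀ x, ∑ y ∈ perturbedNbr supp x, C x y ≤ ρ) (hρ0 : 0 ≤ ρ) (hρ : ρ < 1)
    (hR : ∀ e, ∀ X ∈ supp {e}, e ∈ X → ∀ y ∈ X, ‖e.1 - y.1‖ ≤ R)
    {F : LGConfig d (Matrix.specialUnitaryGroup (Fin N) ℂ) → ℝ} {Δ : Finset (ZdEdge d)} {K : ℝ≥0}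
    (hF : IsLipschitzCylinder (fundamentalRep (Fin N)) F Δ K)
    {μ : Measure (LGConfig d (Matrix.specialUnitaryGroup (Fin N) ℂ))}
    (hμ : μ ∈ perturbedGibbsMeasures (d := d) (fundamentalRep (Fin N)) (N * β) W supp) {r : ℝ} (hr : 0 ≤ r) :
    μ.real {U | r ≤ |F U - ∫ U', F U' ∂μ|} ≤
      2 * exp (-2 * r ^ 2 / (16 * N * (K : ℝ) ^ 2 * d * (Δ.card : ℝ) ^ 2 *
        ((1 + exp (2 * Real.log (max ρ (1 / 2)) / (d * max 1 R))) /
          (1 - exp (2 * Real.log (max ρ (1 / 2)) / (d * max 1 R)))) ^ d)) := by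
  have h := dlr_sum_abs_sub_integral_ge_le_of_isKRContraction hW hWb hsupp hKR hrow hρ hR ({()} : Finset Unit)
    (F := fun _ => F) (Δ := fun _ => Δ) (K := fun _ => K) (fun _ _ => hF)
    (Vc := 16 * N * (K : ℝ) ^ 2 * d * (Δ.card : ℝ) ^ 2 *
        ((1 + exp (2 * Real.log (max ρ (1 / 2)) / (d * max 1 R))) /
          (1 - exp (2 * Real.log (max ρ (1 / 2)) / (d * max 1 R)))) ^ d)
    (fun n => by simpa only [Finset.sum_singleton] using sum_boxLinks_influence_sq_le (N := N) hd hρ0 hρ K Δ n) hμ hr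
  simpa only [Finset.sum_singleton] using h

/-- **GAUSSIAN CONCENTRATION OF TRANSLATE SUMS AT THE VOLUME SCALE, from ANY robust single-link door** (Külske 2003,
Cor. 1-type statement with the constants of `ConcentrationLatticeSums.lean`): under the same hypotheses, for every
Lipschitz cylinder `f` (constant `K`, links `Δ`), EVERY finite set `B` of lattice translations, EVERY DLR state `μ` and
every `r ≥ 0`: `μ{|Σ_{x ∈ B} f ∘ θ_x − ∫ Σ_{x ∈ B} f ∘ θ_x dμ| ≥ r} ≤ 2 exp(−2 r² / (16 N K² d #Δ² Θ₁² · #B))`.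
[folklore] -/
theorem dlr_translates_abs_sub_integral_ge_le (hd : 1 ≤ d) {β ρ R : ℝ}
    {W : Potential (ZdEdge d) (Matrix.specialUnitaryGroup (Fin N) ℂ)} (hW : W.IsAdapted)
    (hWb : ∀ X, ∃ C, ∀ U, |W X U| ≤ C)
    {supp : Finset (ZdEdge d) → Finset (Finset (ZdEdge d))} (hsupp : W.IsSupportedBy supp)
    {C : ZdEdge d → ZdEdge d → ℝ}
    (hKR : IsKRContraction (perturbedYM (d := d) (fundamentalRep (Fin N)) (N * β) W supp) suFrobDist
      (perturbedNbr supp) C)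
    (hrow : ∀ x, ∑ y ∈ perturbedNbr supp x, C x y ≤ ρ) (hρ0 : 0 ≤ ρ) (hρ : ρ < 1)
    (hR : ∀ e, ∀ X ∈ supp {e}, e ∈ X → ∀ y ∈ X, ‖e.1 - y.1‖ ≤ R)
    {f : LGConfig d (Matrix.specialUnitaryGroup (Fin N) ℂ) → ℝ} {Δ : Finset (ZdEdge d)} {K : ℝ≥0}
    (hf : IsLipschitzCylinder (fundamentalRep (Fin N)) f Δ K) (B : Finset (Site d))
    {μ : Measure (LGConfig d (Matrix.specialUnitaryGroup (Fin N) ℂ))}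
    (hμ : μ ∈ perturbedGibbsMeasures (d := d) (fundamentalRep (Fin N)) (N * β) W supp) {r : ℝ} (hr : 0 ≤ r) :
    μ.real {U | r ≤ |(∑ x ∈ B, f (configShift x U)) - ∫ U', ∑ x ∈ B, f (configShift x U') ∂μ|} ≤
      2 * exp (-2 * r ^ 2 / (16 * N * (K : ℝ) ^ 2 * d * (Δ.card : ℝ) ^ 2 *
        (((1 + exp (Real.log (max ρ (1 / 2)) / (d * max 1 R))) /
          (1 - exp (Real.log (max ρ (1 / 2)) / (d * max 1 R)))) ^ d) ^ 2 * B.card)) :=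
  dlr_sum_abs_sub_integral_ge_le_of_isKRContraction hW hWb hsupp hKR hrow hρ hR B
    (F := fun x U => f (configShift x U)) (Δ := fun x => Δ.image fun e : ZdEdge d => (e.1 - x, e.2))
    (K := fun _ => K) (fun x _ => isLipschitzCylinder_comp_configShift hf x)
    (fun n => sum_boxLinks_influence_translates_sq_le hd hρ0 hρ K Δ B n) hμ hr

/-- **SELF-AVERAGING AT AN EXPONENTIAL RATE IN THE VOLUME** (empirical-average form): under the same hypotheses, for
`B` nonempty and every `a ≥ 0`, with `v := 16 N K² d #Δ² Θ₁²`: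
`μ{|Σ_{x ∈ B} f ∘ θ_x − ∫ Σ_{x ∈ B} f ∘ θ_x dμ| ≥ a · #B} ≤ 2 exp(−2 a² #B / v)`. [folklore] -/
theorem dlr_translates_average_ge_le (hd : 1 ≤ d) {β ρ R : ℝ}
    {W : Potential (ZdEdge d) (Matrix.specialUnitaryGroup (Fin N) ℂ)} (hW : W.IsAdapted)
    (hWb : ∀ X, ∃ C, ∀ U, |W X U| ≤ C)
    {supp : Finset (ZdEdge d) → Finset (Finset (ZdEdge d))} (hsupp : W.IsSupportedBy supp)
    {C : ZdEdge d → ZdEdge d → ℝ}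
    (hKR : IsKRContraction (perturbedYM (d := d) (fundamentalRep (Fin N)) (N * β) W supp) suFrobDist
      (perturbedNbr supp) C)
    (hrow : ∀ x, ∑ y ∈ perturbedNbr supp x, C x y ≤ ρ) (hρ0 : 0 ≤ ρ) (hρ : ρ < 1)
    (hR : ∀ e, ∀ X ∈ supp {e}, e ∈ X → ∀ y ∈ X, ‖e.1 - y.1‖ ≤ R)
    {f : LGConfig d (Matrix.specialUnitaryGroup (Fin N) ℂ) → ℝ} {Δ : Finset (ZdEdge d)} {K : ℝ≥0}
    (hf : IsLipschitzCylinder (fundamentalRep (Fin N)) f Δ K) {B : Finset (Site d)} (hB : B.Nonempty)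
    {μ : Measure (LGConfig d (Matrix.specialUnitaryGroup (Fin N) ℂ))}
    (hμ : μ ∈ perturbedGibbsMeasures (d := d) (fundamentalRep (Fin N)) (N * β) W supp) {a : ℝ} (ha : 0 ≤ a) :
    μ.real {U | a * B.card ≤ |(∑ x ∈ B, f (configShift x U)) - ∫ U', ∑ x ∈ B, f (configShift x U') ∂μ|} ≤
      2 * exp (-2 * a ^ 2 * B.card / (16 * N * (K : ℝ) ^ 2 * d * (Δ.card : ℝ) ^ 2 *
        (((1 + exp (Real.log (max ρ (1 / 2)) / (d * max 1 R))) /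
          (1 - exp (Real.log (max ρ (1 / 2)) / (d * max 1 R)))) ^ d) ^ 2)) := by
  have hBpos : (0 : ℝ) < B.card := by exact_mod_cast hB.card_pos
  have h := dlr_translates_abs_sub_integral_ge_le hd hW hWb hsupp hKR hrow hρ0 hρ hR hf B hμ (r := a * B.card)
    (mul_nonneg ha hBpos.le)
  refine h.trans (le_of_eq ?_)
  congr 2
  set v : ℝ := 16 * N * (K : ℝ) ^ 2 * d * (Δ.card : ℝ) ^ 2 *
    (((1 + exp (Real.log (max ρ (1 / 2)) / (d * max 1 R))) /
      (1 - exp (Real.log (max ρ (1 / 2)) / (d * max 1 R)))) ^ d) ^ 2 with hv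
  rcases eq_or_ne v 0 with hv0 | hv0
  · rw [hv0, zero_mul, div_zero, div_zero]
  · field_simp


/-! ### The pair door, every `d`, every `N` -/

/-- **GAUSSIAN CONCENTRATION OF TRANSLATE AVERAGES, UNIFORMLY ON THE TIER-1 BALL, from the single-link pair door.** Let
`c ≥ 0` be a one-link Poincaré constant and `v₀ ≥ 0` a linear variance bound on the operator-norm ball
`b ≥ 2(d−1)|β|`, and let `6(d−1)|β| e^{ε₀}√(c v₀) + e^{ε₀/2}√c ε₁ ≤ ρ < 1`, `0 ≤ ρ`. Then for every member of
`MemBallZd ε₀ ε₁ R`, EVERY DLR state `μ`, every Lipschitz cylinder `f` (constant `K`, links `Δ`), every nonempty finite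
set `B` of translations and every `a ≥ 0`:
`μ{|Σ_{x∈B} f∘θ_x − ∫ Σ dμ| ≥ a·#B} ≤ 2 exp(−2 a² #B / (16 N K² d #Δ² Θ₁²))`. [folklore] -/
theorem translates_average_ge_le_of_pair (hd : 1 ≤ d) (hN : 1 ≤ N) {β b c v ε₀ ε₁ ρ R : ℝ} (hc : 0 ≤ c)
    (hv : 0 ≤ v) (hb : |β| * (2 * ((d : ℝ) - 1)) ≤ b)
    (hP : ∀ B : Matrix (Fin N) (Fin N) ℂ, matrixOpNorm B ≤ b →
      ∀ (ψ : Matrix.specialUnitaryGroup (Fin N) ℂ → ℝ) (M : ℝ), 0 ≤ M →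
        (∀ x y, |ψ x - ψ y| ≤ M * suFrobDist x y) →
        Var[ψ; (haarProbability (Matrix.specialUnitaryGroup (Fin N) ℂ)).tilted
          fun g => (N : ℝ) * ((g : Matrix (Fin N) (Fin N) ℂ) * B).trace.re] ≤ c * M ^ 2)
    (hVB : ∀ B : Matrix (Fin N) (Fin N) ℂ, matrixOpNorm B ≤ b → ∀ Δ : Matrix (Fin N) (Fin N) ℂ,
      Var[fun g : Matrix.specialUnitaryGroup (Fin N) ℂ =>
          (N : ℝ) * ((g : Matrix (Fin N) (Fin N) ℂ) * Δ).trace.re;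
        (haarProbability (Matrix.specialUnitaryGroup (Fin N) ℂ)).tilted
          fun g => (N : ℝ) * ((g : Matrix (Fin N) (Fin N) ℂ) * B).trace.re] ≤ v * frobNorm Δ ^ 2)
    (hρ : 6 * ((d : ℝ) - 1) * |β| * (exp ε₀ * Real.sqrt (c * v)) + exp (ε₀ / 2) * Real.sqrt c * ε₁ ≤ ρ)
    (hρ0 : 0 ≤ ρ) (hρ1 : ρ < 1) {W : Potential (ZdEdge d) (Matrix.specialUnitaryGroup (Fin N) ℂ)}
    {supp : Finset (ZdEdge d) → Finset (Finset (ZdEdge d))} (hmem : MemBallZd ε₀ ε₁ R W supp)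
    {μ : Measure (LGConfig d (Matrix.specialUnitaryGroup (Fin N) ℂ))}
    (hμ : μ ∈ perturbedGibbsMeasures (d := d) (fundamentalRep (Fin N)) (N * β) W supp)
    {f : LGConfig d (Matrix.specialUnitaryGroup (Fin N) ℂ) → ℝ} {Δ : Finset (ZdEdge d)} {K : ℝ≥0}
    (hf : IsLipschitzCylinder (fundamentalRep (Fin N)) f Δ K) {B : Finset (Site d)} (hB : B.Nonempty)
    {a : ℝ} (ha : 0 ≤ a) :
    μ.real {U | a * B.card ≤ |(∑ x ∈ B, f (configShift x U)) - ∫ U', ∑ x ∈ B, f (configShift x U') ∂μ|} ≤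
      2 * exp (-2 * a ^ 2 * B.card / (16 * N * (K : ℝ) ^ 2 * d * (Δ.card : ℝ) ^ 2 *
        (((1 + exp (Real.log (max ρ (1 / 2)) / (d * max 1 R))) /
          (1 - exp (Real.log (max ρ (1 / 2)) / (d * max 1 R)))) ^ d) ^ 2)) := by
  haveI : SecondCountableTopology (Matrix (Fin N) (Fin N) ℂ) :=
    inferInstanceAs (SecondCountableTopology (Fin N → Fin N → ℂ))
  haveI : SecondCountableTopology (Matrix.specialUnitaryGroup (Fin N) ℂ) :=
    Topology.IsEmbedding.subtypeVal.secondCountableTopology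
  obtain ⟨osc, lip, hosc, hlip, hosca, hΛ⟩ := hmem.loads
  have hW : W.IsAdapted := fun X => ⟨hmem.dependsOn X, (hmem.continuous X).measurable⟩
  have hWb : ∀ X, ∃ C, ∀ U, |W X U| ≤ C := fun X => exists_bound_of_continuous (hmem.continuous X)
  have hKR := isKRContraction_perturbedYM_SU hd hN hc hv hb hP hVB hW (supp := supp) hosc hosca hlip
  have hrow : ∀ x, ∑ y ∈ perturbedNbr supp x,
      (exp ε₀ * Real.sqrt (c * v) * |β| * linkInfluence x y +
        exp (ε₀ / 2) * Real.sqrt c * ∑ X ∈ (supp {x}).filter (fun X => x ∈ X), lip X y) ≤ ρ :=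
    fun x => (sum_perturbedNbr_coeff_le hd (β := β) (c := c) (v := v) (a := ε₀) hΛ x).trans hρ
  exact dlr_translates_average_ge_le hd hW hWb hmem.supportedBy hKR hrow hρ0 hρ1 hmem.range hf hB hμ ha

/-! ### `SU(2)`, hypothesis-free -/

/-- **`SU(2)`, HYPOTHESIS-FREE, every `d ≥ 1`** (sharp one-link Poincaré constant `2/3`, `√(c v₀) = 4/3`; Wilson units
`β = β_W/4`): if `2(d−1)|β_W| e^{ε₀} + e^{ε₀/2} √(2/3) ε₁ ≤ ρ < 1` (`0 ≤ ρ`) then on the whole ball `MemBallZd ε₀ ε₁ R`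
every DLR state satisfies `μ{|Σ_{x∈B} f∘θ_x − ∫ Σ dμ| ≥ a·#B} ≤ 2 exp(−2 a² #B / (32 K² d #Δ² Θ₁²))`. [folklore] -/
theorem su2_translates_average_ge_le (hd : 1 ≤ d) {βW ε₀ ε₁ ρ R : ℝ}
    (hρ : 2 * ((d : ℝ) - 1) * |βW| * exp ε₀ + exp (ε₀ / 2) * Real.sqrt (2 / 3) * ε₁ ≤ ρ) (hρ0 : 0 ≤ ρ)
    (hρ1 : ρ < 1) {W : Potential (ZdEdge d) (Matrix.specialUnitaryGroup (Fin 2) ℂ)}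
    {supp : Finset (ZdEdge d) → Finset (Finset (ZdEdge d))} (hmem : MemBallZd ε₀ ε₁ R W supp)
    {μ : Measure (LGConfig d (Matrix.specialUnitaryGroup (Fin 2) ℂ))}
    (hμ : μ ∈ perturbedGibbsMeasures (d := d) (fundamentalRep (Fin 2)) ((2 : ℕ) * (βW / 4)) W supp)
    {f : LGConfig d (Matrix.specialUnitaryGroup (Fin 2) ℂ) → ℝ} {Δ : Finset (ZdEdge d)} {K : ℝ≥0}
    (hf : IsLipschitzCylinder (fundamentalRep (Fin 2)) f Δ K) {B : Finset (Site d)} (hB : B.Nonempty)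
    {a : ℝ} (ha : 0 ≤ a) :
    μ.real {U | a * B.card ≤ |(∑ x ∈ B, f (configShift x U)) - ∫ U', ∑ x ∈ B, f (configShift x U') ∂μ|} ≤
      2 * exp (-2 * a ^ 2 * B.card / (16 * (2 : ℕ) * (K : ℝ) ^ 2 * d * (Δ.card : ℝ) ^ 2 *
        (((1 + exp (Real.log (max ρ (1 / 2)) / (d * max 1 R))) /
          (1 - exp (Real.log (max ρ (1 / 2)) / (d * max 1 R)))) ^ d) ^ 2)) := by
  have hc : (0 : ℝ) ≤ 2 / 3 := by norm_num
  have hP : ∀ B : Matrix (Fin 2) (Fin 2) ℂ, matrixOpNorm B ≤ |βW / 4| * (2 * ((d : ℝ) - 1)) →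
      ∀ (ψ : Matrix.specialUnitaryGroup (Fin 2) ℂ → ℝ) (M : ℝ), 0 ≤ M →
        (∀ x y, |ψ x - ψ y| ≤ M * suFrobDist x y) →
        Var[ψ; (haarProbability (Matrix.specialUnitaryGroup (Fin 2) ℂ)).tilted
          fun g => ((2 : ℕ) : ℝ) * ((g : Matrix (Fin 2) (Fin 2) ℂ) * B).trace.re] ≤ 2 / 3 * M ^ 2 :=
    fun B hB ψ M hM hψ => oneLinkPoincareSUN_two_sharp _ B hB ψ M hM hψ
  have hVB := linVariance_of_poincare (N := 2) hP
  have hv : (0 : ℝ) ≤ 2 / 3 * ((2 : ℕ) : ℝ) ^ 2 := by norm_num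
  have hsq : Real.sqrt (2 / 3 * (2 / 3 * ((2 : ℕ) : ℝ) ^ 2)) = 4 / 3 := by
    rw [show (2 / 3 * (2 / 3 * ((2 : ℕ) : ℝ) ^ 2) : ℝ) = (4 / 3) ^ 2 by norm_num, Real.sqrt_sq (by norm_num)]
  have hρ' : 6 * ((d : ℝ) - 1) * |βW / 4| * (exp ε₀ * Real.sqrt (2 / 3 * (2 / 3 * ((2 : ℕ) : ℝ) ^ 2))) +
      exp (ε₀ / 2) * Real.sqrt (2 / 3) * ε₁ ≤ ρ := by
    rw [hsq]
    have e : 6 * ((d : ℝ) - 1) * |βW / 4| * (exp ε₀ * (4 / 3)) = 2 * ((d : ℝ) - 1) * |βW| * exp ε₀ := by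
      rw [abs_div, abs_of_pos (by norm_num : (0 : ℝ) < 4)]
      ring
    rw [e]
    exact hρ
  exact translates_average_ge_le_of_pair hd (by norm_num) (R := R) hc hv le_rfl hP hVB hρ' hρ0 hρ1 hmem hμ hf hB ha

/-- **The `d = 4` reading for `SU(2)`**: `6|β_W| e^{ε₀} + e^{ε₀/2} √(2/3) ε₁ ≤ ρ < 1` (`0 ≤ ρ`) ⇒ on the whole ball
`MemBallZd ε₀ ε₁ R` every DLR state satisfies, for every Lipschitz cylinder, every nonempty `B`, every `a ≥ 0`:
`μ{|Σ_{x∈B} f∘θ_x − ∫ Σ dμ| ≥ a·#B} ≤ 2 exp(−2 a² #B / (128 K² #Δ² Θ₁²))`, `Θ₁ = ((1+r₁)/(1−r₁))^4`,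
`r₁ = exp(log max(ρ,½)/(4 max(1,R)))`. [folklore] -/
theorem su2_translates_average_ge_le_dim4 {βW ε₀ ε₁ ρ R : ℝ}
    (hρ : 6 * |βW| * exp ε₀ + exp (ε₀ / 2) * Real.sqrt (2 / 3) * ε₁ ≤ ρ) (hρ0 : 0 ≤ ρ) (hρ1 : ρ < 1)
    {W : Potential (ZdEdge 4) (Matrix.specialUnitaryGroup (Fin 2) ℂ)}
    {supp : Finset (ZdEdge 4) → Finset (Finset (ZdEdge 4))} (hmem : MemBallZd ε₀ ε₁ R W supp)
    {μ : Measure (LGConfig 4 (Matrix.specialUnitaryGroup (Fin 2) ℂ))}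
    (hμ : μ ∈ perturbedGibbsMeasures (d := 4) (fundamentalRep (Fin 2)) ((2 : ℕ) * (βW / 4)) W supp)
    {f : LGConfig 4 (Matrix.specialUnitaryGroup (Fin 2) ℂ) → ℝ} {Δ : Finset (ZdEdge 4)} {K : ℝ≥0}
    (hf : IsLipschitzCylinder (fundamentalRep (Fin 2)) f Δ K) {B : Finset (Site 4)} (hB : B.Nonempty)
    {a : ℝ} (ha : 0 ≤ a) :
    μ.real {U | a * B.card ≤ |(∑ x ∈ B, f (configShift x U)) - ∫ U', ∑ x ∈ B, f (configShift x U') ∂μ|} ≤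
      2 * exp (-2 * a ^ 2 * B.card / (128 * (K : ℝ) ^ 2 * (Δ.card : ℝ) ^ 2 *
        (((1 + exp (Real.log (max ρ (1 / 2)) / (4 * max 1 R))) /
          (1 - exp (Real.log (max ρ (1 / 2)) / (4 * max 1 R)))) ^ 4) ^ 2)) := by
  have h := su2_translates_average_ge_le (d := 4) (by norm_num) (by
    have h6 : (2 : ℝ) * (((4 : ℕ) : ℝ) - 1) = 6 := by norm_num
    calc 2 * (((4 : ℕ) : ℝ) - 1) * |βW| * exp ε₀ + exp (ε₀ / 2) * Real.sqrt (2 / 3) * ε₁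
        = 6 * |βW| * exp ε₀ + exp (ε₀ / 2) * Real.sqrt (2 / 3) * ε₁ := by rw [h6]
      _ ≤ ρ := hρ) hρ0 hρ1 hmem hμ hf hB ha
  refine h.trans (le_of_eq ?_)
  congr 2
  push_cast
  ring

/-! ### Every `N ≥ 2`: the Bakry–Émery pair, hypothesis-free -/

/-- **ALL `N ≥ 2`, EVERY `d ≥ 1`, HYPOTHESIS-FREE — concentration of translate averages uniformly on the tier-1 ball from
the Bakry–Émery one-link pair** (`b = 2(d−1)|β| < 1/2`):
`6(d−1)|β| e^{ε₀}/(1/2 − b) + e^{ε₀/2} ε₁/√(N(1/2 − b)) ≤ ρ < 1` (`0 ≤ ρ`) ⇒ for every member of `MemBallZd ε₀ ε₁ R`,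
every DLR state, every Lipschitz cylinder, nonempty `B`, `a ≥ 0`:
`μ{|Σ_{x∈B} f∘θ_x − ∫ Σ dμ| ≥ a·#B} ≤ 2 exp(−2 a² #B / (16 N K² d #Δ² Θ₁²))`. [folklore] -/
theorem suN_translates_average_ge_le_bakryEmery (hd : 1 ≤ d) (hN : 2 ≤ N) {β ε₀ ε₁ ρ R : ℝ}
    (hb : |β| * (2 * ((d : ℝ) - 1)) < 1 / 2)
    (hρ : 6 * ((d : ℝ) - 1) * |β| * exp ε₀ / (1 / 2 - |β| * (2 * ((d : ℝ) - 1))) +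
      exp (ε₀ / 2) * ε₁ / Real.sqrt ((N : ℝ) * (1 / 2 - |β| * (2 * ((d : ℝ) - 1)))) ≤ ρ) (hρ0 : 0 ≤ ρ)
    (hρ1 : ρ < 1) {W : Potential (ZdEdge d) (Matrix.specialUnitaryGroup (Fin N) ℂ)}
    {supp : Finset (ZdEdge d) → Finset (Finset (ZdEdge d))} (hmem : MemBallZd ε₀ ε₁ R W supp)
    {μ : Measure (LGConfig d (Matrix.specialUnitaryGroup (Fin N) ℂ))}
    (hμ : μ ∈ perturbedGibbsMeasures (d := d) (fundamentalRep (Fin N)) (N * β) W supp)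
    {f : LGConfig d (Matrix.specialUnitaryGroup (Fin N) ℂ) → ℝ} {Δ : Finset (ZdEdge d)} {K : ℝ≥0}
    (hf : IsLipschitzCylinder (fundamentalRep (Fin N)) f Δ K) {B : Finset (Site d)} (hB : B.Nonempty)
    {a : ℝ} (ha : 0 ≤ a) :
    μ.real {U | a * B.card ≤ |(∑ x ∈ B, f (configShift x U)) - ∫ U', ∑ x ∈ B, f (configShift x U') ∂μ|} ≤
      2 * exp (-2 * a ^ 2 * B.card / (16 * N * (K : ℝ) ^ 2 * d * (Δ.card : ℝ) ^ 2 *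
        (((1 + exp (Real.log (max ρ (1 / 2)) / (d * max 1 R))) /
          (1 - exp (Real.log (max ρ (1 / 2)) / (d * max 1 R)))) ^ d) ^ 2)) := by
  set b : ℝ := |β| * (2 * ((d : ℝ) - 1)) with hbdef
  have hNpos : (0 : ℝ) < N := by exact_mod_cast (show 0 < N by omega)
  have hgap : 0 < 1 / 2 - b := by linarith
  have hP := oneLinkPoincareSUN_bakryEmery hN hb
  have hV := oneLinkVarianceBound_bakryEmery hN hb
  have hc : (0 : ℝ) ≤ 1 / ((N : ℝ) * (1 / 2 - b)) := by positivity
  have hv : (0 : ℝ) ≤ (N : ℝ) / (1 / 2 - b) := by positivity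
  refine translates_average_ge_le_of_pair hd (by omega) hc hv le_rfl (fun B hB => hP B hB)
    (fun B hB => hV B hB) ?_ hρ0 hρ1 hmem hμ hf hB ha
  have hsq1 : Real.sqrt (1 / ((N : ℝ) * (1 / 2 - b)) * ((N : ℝ) / (1 / 2 - b))) = 1 / (1 / 2 - b) := by
    rw [show 1 / ((N : ℝ) * (1 / 2 - b)) * ((N : ℝ) / (1 / 2 - b)) = (1 / (1 / 2 - b)) ^ 2 by field_simp,
      Real.sqrt_sq (by positivity)]
  have hsq2 : Real.sqrt (1 / ((N : ℝ) * (1 / 2 - b))) = 1 / Real.sqrt ((N : ℝ) * (1 / 2 - b)) := by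
    rw [Real.sqrt_div' _ (mul_nonneg hNpos.le hgap.le), Real.sqrt_one]
  rw [hsq1, hsq2]
  calc 6 * ((d : ℝ) - 1) * |β| * (exp ε₀ * (1 / (1 / 2 - b))) + exp (ε₀ / 2) * (1 / Real.sqrt ((N : ℝ) * (1 / 2 - b))) * ε₁
      = 6 * ((d : ℝ) - 1) * |β| * exp ε₀ / (1 / 2 - b) + exp (ε₀ / 2) * ε₁ / Real.sqrt ((N : ℝ) * (1 / 2 - b)) := by
        ring
    _ ≤ ρ := hρ

/-! ### The Wilson point: `SU(2)` lattice Yang–Mills on `ℤ⁴`, `0 ≤ β_W ≤ 1/12` -/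

/-- **THE WILSON POINT — SELF-AVERAGING OF `SU(2)` LATTICE YANG–MILLS ON `ℤ⁴` AT STRONG COUPLING**: for
`0 ≤ β_W ≤ 1/12`, EVERY DLR state `μ` (tree coupling `β_W/2`), every Lipschitz cylinder `f` (constant `K`, links `Δ` —
e.g. the plaquette), every nonempty finite set `B` of lattice translations and every `a ≥ 0`:
`μ{|Σ_{x∈B} f∘θ_x − ∫ Σ_{x∈B} f∘θ_x dμ| ≥ a·#B} ≤ 2 exp(−2 a² #B / (128 K² #Δ² Θ²))`, `Θ = ((1+r)/(1−r))^4`,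
`r = exp(log(1/2)/4) = 2^{−1/4}` (row sum `6β_W ≤ 1/2`, the zero member of the ball, range `0`). [folklore] -/
theorem su2_wilson_translates_average_upTo_oneTwelfth {βW : ℝ} (h0 : 0 ≤ βW) (h : βW ≤ 1 / 12)
    {μ : Measure (LGConfig 4 (Matrix.specialUnitaryGroup (Fin 2) ℂ))}
    (hμ : μ ∈ ymGibbsMeasures (d := 4) (fundamentalRep (Fin 2)) (βW / 2))
    {f : LGConfig 4 (Matrix.specialUnitaryGroup (Fin 2) ℂ) → ℝ} {Δ : Finset (ZdEdge 4)} {K : ℝ≥0}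
    (hf : IsLipschitzCylinder (fundamentalRep (Fin 2)) f Δ K) {B : Finset (Site 4)} (hB : B.Nonempty)
    {a : ℝ} (ha : 0 ≤ a) :
    μ.real {U | a * B.card ≤ |(∑ x ∈ B, f (configShift x U)) - ∫ U', ∑ x ∈ B, f (configShift x U') ∂μ|} ≤
      2 * exp (-2 * a ^ 2 * B.card / (128 * (K : ℝ) ^ 2 * (Δ.card : ℝ) ^ 2 *
        (((1 + exp (Real.log (1 / 2) / 4)) / (1 - exp (Real.log (1 / 2) / 4))) ^ 4) ^ 2)) := by
  have hβ : (((2 : ℕ) : ℝ) * (βW / 4) : ℝ) = βW / 2 := by push_cast; ring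
  have hmem : MemBallZd (N := 2) (0 : ℝ) 0 0 (0 : Potential (ZdEdge 4) (Matrix.specialUnitaryGroup (Fin 2) ℂ))
      (fun _ => (∅ : Finset (Finset (ZdEdge 4)))) :=
    memBallZd_zero le_rfl le_rfl fun _ _ h => by simp at h
  have hμ' : μ ∈ perturbedGibbsMeasures (d := 4) (fundamentalRep (Fin 2)) ((2 : ℕ) * (βW / 4)) 0
      (fun _ => (∅ : Finset (Finset (ZdEdge 4)))) := by
    rwa [perturbedGibbsMeasures_zero, hβ]
  have key := su2_translates_average_ge_le_dim4 (ρ := 1 / 2) (ε₀ := 0) (ε₁ := 0) (R := 0) (by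
      rw [abs_of_nonneg h0, Real.exp_zero, zero_div, Real.exp_zero]
      linarith) (by norm_num) (by norm_num) hmem hμ' hf hB ha
  rw [max_self, max_eq_left (zero_le_one : (0 : ℝ) ≤ 1), mul_one] at key
  exact key

/-- **WILSON LOOPS SELF-AVERAGE** (`SU(2)`, `ℤ⁴`, `0 ≤ β_W ≤ 1/12`): for EVERY DLR state `μ`, every closed lattice walk `γ` and
coupling `c` (the loop term `c · Re tr U_γ / 2`, a Lipschitz cylinder of constant `|c|·√2·|γ|` on the `#links(γ)` links of `γ`,
`isLipschitzCylinder_loopTerm`), every nonempty finite set `B` of translations and every `a ≥ 0`: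
`μ{|Σ_{x∈B} (c W_γ)∘θ_x − ∫ Σ dμ| ≥ a·#B} ≤ 2 exp(−2 a² #B / (128 (|c|√2|γ|)² #links(γ)² Θ₁²))` (`= 256 c² |γ|² #links(γ)² Θ₁²`) —
the translate-averaged Wilson loop estimator of lattice practice concentrates exponentially in the number of translates. [folklore] -/
theorem su2_wilson_loop_translates_average_upTo_oneTwelfth {βW : ℝ} (h0 : 0 ≤ βW) (h : βW ≤ 1 / 12)
    {μ : Measure (LGConfig 4 (Matrix.specialUnitaryGroup (Fin 2) ℂ))}
    (hμ : μ ∈ ymGibbsMeasures (d := 4) (fundamentalRep (Fin 2)) (βW / 2)) (c : ℝ)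
    {x₀ : Literature.Probability.LatticeModels.Site 4} (w : (zdGraph 4).Walk x₀ x₀) {B : Finset (Site 4)} (hB : B.Nonempty)
    {a : ℝ} (ha : 0 ≤ a) :
    μ.real {U | a * B.card ≤ |(∑ x ∈ B, loopTerm 2 c w (configShift x U)) -
        ∫ U', ∑ x ∈ B, loopTerm 2 c w (configShift x U') ∂μ|} ≤
      2 * exp (-2 * a ^ 2 * B.card / (128 * (|c| * Real.sqrt 2 * (w.length : ℝ)) ^ 2 * ((walkEdges w).card : ℝ) ^ 2 *
        (((1 + exp (Real.log (1 / 2) / 4)) / (1 - exp (Real.log (1 / 2) / 4))) ^ 4) ^ 2)) :=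
  su2_wilson_translates_average_upTo_oneTwelfth h0 h hμ (isLipschitzCylinder_loopTerm (N := 2) c w) hB ha

/-- **THE PLAQUETTE SELF-AVERAGES** (`SU(2)`, `ℤ⁴`, `0 ≤ β_W ≤ 1/12`): for EVERY DLR state `μ`, every plaquette observable
`W_p = Re tr U_p / 2` in the plane `(i, j)` at `x` (the tree's `zdPlaquetteObs`, a Lipschitz cylinder of constant `4·2³` on the four
links of `p`, `isLipschitzCylinder_zdPlaquetteObs`), every nonempty finite set `B` of translations and every `a ≥ 0`:
`μ{|Σ_{y∈B} W_p∘θ_y − ∫ Σ dμ| ≥ a·#B} ≤ 2 exp(−2 a² #B / (128 · 32² · #links(p)² · Θ₁²))` — the mean plaquette of ANY finite region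
deviates from its expectation by `a` with probability `≤ 2 e^{−c a² #B}`, `c > 0` explicit. [folklore] -/
theorem su2_wilson_plaquette_average_upTo_oneTwelfth {βW : ℝ} (h0 : 0 ≤ βW) (h : βW ≤ 1 / 12)
    {μ : Measure (LGConfig 4 (Matrix.specialUnitaryGroup (Fin 2) ℂ))}
    (hμ : μ ∈ ymGibbsMeasures (d := 4) (fundamentalRep (Fin 2)) (βW / 2))
    (x : Literature.Probability.LatticeModels.Site 4) {i j : Fin 4} (hij : i < j) {B : Finset (Site 4)} (hB : B.Nonempty)
    {a : ℝ} (ha : 0 ≤ a) :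
    μ.real {U | a * B.card ≤ |(∑ y ∈ B, zdPlaquetteObs (d := 4) (fundamentalRep (Fin 2)) x i j (configShift y U)) -
        ∫ U', ∑ y ∈ B, zdPlaquetteObs (d := 4) (fundamentalRep (Fin 2)) x i j (configShift y U') ∂μ|} ≤
      2 * exp (-2 * a ^ 2 * B.card / (128 * ((4 * (2 : ℝ≥0) ^ 3 : ℝ≥0) : ℝ) ^ 2 *
        ((plaquetteEdges ((x, ⟨(i, j), hij⟩) : ZdPlaquette 4)).card : ℝ) ^ 2 *
        (((1 + exp (Real.log (1 / 2) / 4)) / (1 - exp (Real.log (1 / 2) / 4))) ^ 4) ^ 2)) :=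
  su2_wilson_translates_average_upTo_oneTwelfth h0 h hμ (isLipschitzCylinder_zdPlaquetteObs x hij) hB ha

end Summit.Ventures.YMGap.RobustBall

end
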